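import Summits.BirchSwinnertonDyer.Rank1Residual.Additive.X3BranchLineCharacterQuadratic
import HarnessLib

/-!
# X3 certificate road at `p = 3`: the per-pair line certificate WITH ITS CHARACTERS for a kernel
# discriminant `D = 2q`, `q ≡ 3 (mod 4)` prime (kernel field `ℚ(√(2q))`, character `(χ₈χ₄)·(·/q)` modulo
# `8q`, quotient character `ψ = ω₃·φ⁻¹` of level `24q`) — cell `bsd-eis`, seat `bsd-eis-x3` gen 5;
# THEOREMS ONLY, nothing booked

HONEST FRAMING (FULL-BSD rank-`≤ 1` programme D-0033, `run/shared/lean/pub/bsd-eis/README.md` §4;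
excluded-domain X3 = additive reducible, row B2 `r = 0`, (M), NON-degenerate). A TOOL: the `D = 2q`
(`q ≡ 3 (mod 4)`) analogue of `exists_lineDatum_three_characters_of_cert_two_mul_prime_three_mod_four` for the generated
per-pair displays (`22` composite-discriminant classes: `D ∈ {14, 22, 38, 46}`). The radical is
`√(2q) = √2·ζ₄·√q*` (`q* = −q`): character `χ₈·χ₄` at level `8` (conductor `8`: value `−1` at `5`) times
`(·/q)`, multiplied twice by `Rat.smul_mul_eq_changeLevel_mul`.

* `isPrimitive_eight_three_of_apply_five` — a character mod `8` read in `𝔽₃` with `χ(5) = −1` is primitive;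
* `chi8chi4LegendreCharacter_three_isPrimitive` / `…_apply_natCast` — conductor `8q`, VALUE TABLE;
* `exists_lineDatum_three_characters_of_cert_two_mul_prime_three_mod_four_three_mod_four` — the packaging.

References: [GreenbergVatsal2000] §2 p. 28; [Washington1997] Ch. 2–3; [IrelandRosen1990] Ch. 6 Prop. 6.3.2.
-/

set_option autoImplicit false

noncomputable section

open scoped Classical NumberField

namespace Summit.BirchSwinnertonDyer.Rank1Residual.Additive

open WeierstrassCurve Polynomial NumberField IsDedekindDomain Field
  Literature.NumberTheory.GaloisRepresentations
  Literature.NumberTheory.EllipticCurves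
  Literature.NumberTheory.EllipticCurves.Rank1Residual
  Summit.BirchSwinnertonDyer.Rank1Residual.GaloisImage.RamifiedOrdinaryLineTwist

/-- Characters with coprime conductors: `f(χψ) = f(χ)·f(ψ)` (the tree's `RouteUPsiD11` §1 /
`X3BranchQuotCharacter` §1 argument). [cite: Washington1997, Ch. 3 (conductor of a product of characters of coprime conductor)] -/
private theorem conductor_mul_eq_mul_of_coprime₅ {R : Type*} [CommRing R] [IsDomain R] {n : ℕ}
    [NeZero n] (χ ψ : DirichletCharacter R n) (h : χ.conductor.Coprime ψ.conductor) :
    (χ * ψ).conductor = χ.conductor * ψ.conductor := by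
  apply Nat.dvd_antisymm
  · have := DirichletCharacter.conductor_mul_dvd_lcm_conductor χ ψ
    rwa [h.lcm_eq_mul] at this
  · have hχ : χ.conductor ∣ (χ * ψ).conductor := by
      have h1 : χ = (χ * ψ) * ψ⁻¹ := by rw [mul_assoc, mul_inv_cancel, mul_one]
      have h2 := DirichletCharacter.conductor_mul_dvd_lcm_conductor (χ * ψ) ψ⁻¹
      rw [← h1, DirichletCharacter.conductor_inv] at h2
      exact h.dvd_of_dvd_mul_right (h2.trans (Nat.lcm_dvd_mul _ _))
    have hψ : ψ.conductor ∣ (χ * ψ).conductor := by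
      have h1 : ψ = (χ * ψ) * χ⁻¹ := by rw [mul_comm χ ψ, mul_assoc, mul_inv_cancel, mul_one]
      have h2 := DirichletCharacter.conductor_mul_dvd_lcm_conductor (χ * ψ) χ⁻¹
      rw [← h1, DirichletCharacter.conductor_inv] at h2
      exact h.symm.dvd_of_dvd_mul_right (h2.trans (Nat.lcm_dvd_mul _ _))
    exact h.mul_dvd_of_dvd_of_dvd hχ hψ

/-- **A Dirichlet character modulo `8` read in `𝔽₃` with `χ(5) = −1` is PRIMITIVE** (its conductor
divides `8` but not `4`, since `5 ≡ 1 (mod 4)`; the tree's `isPrimitive_of_apply_five_eq_neg_one` over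
`𝔽₃`). [cite: Washington1997, Ch. 3 (conductors of Dirichlet characters)] -/
theorem isPrimitive_eight_three_of_apply_five (χ : DirichletCharacter (ZMod 3) 8) (h5 : χ (5 : ℤ) = -1) :
    χ.IsPrimitive := by
  rw [DirichletCharacter.isPrimitive_def]
  have hdvd : χ.conductor ∣ 2 ^ 3 := χ.conductor_dvd_level
  have hnot : ¬ χ.conductor ∣ 4 := by
    intro h4
    have hmem : 4 ∈ χ.conductorSet :=
      (χ.mem_conductorSet_iff_conductor_dvd (show 4 ∣ 8 by norm_num)).mpr h4
    obtain ⟨hd, χ₀, hχ₀⟩ := (χ.mem_conductorSet_iff.mp hmem)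
    have hcop : IsCoprime (5 : ℤ) (8 : ℕ) := by
      rw [Int.isCoprime_iff_gcd_eq_one]; decide
    have h5' : χ (5 : ℤ) = χ₀ (5 : ℤ) := by
      rw [hχ₀, DirichletCharacter.changeLevel_eq_cast_of_dvd' χ₀ hd hcop]
    have h51 : ((5 : ℤ) : ZMod 4) = 1 := by decide
    rw [h5, h51, map_one] at h5'
    exact absurd h5' (by decide)
  obtain ⟨k, hk, hk'⟩ := (Nat.dvd_prime_pow Nat.prime_two).mp hdvd
  interval_cases k
  · exact absurd (hk' ▸ one_dvd 4) hnot
  · exact absurd (hk' ▸ (show 2 ∣ 4 by norm_num)) hnot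
  · exact absurd (hk' ▸ dvd_refl 4) hnot
  · rw [hk']; norm_num

variable {q : ℕ} [hq : Fact q.Prime]

/-- **`φ = (χ₈χ₄)·(·/q)` read in `𝔽₃` is PRIMITIVE of conductor `8q`** (`q` an odd prime): the conductors
`8` (value `−1` at `5`) and `q` (`X3Branch.legendreCharacter_isPrimitive`) are coprime.
[cite: Washington1997, Ch. 3 (conductors of Dirichlet characters)] -/
theorem chi8chi4LegendreCharacter_three_isPrimitive (hq2 : q ≠ 2) :
    DirichletCharacter.IsPrimitive
      ((DirichletCharacter.changeLevel (dvd_mul_right 8 q) (DirichletCharacter.changeLevel (dvd_refl 8) ZMod.χ₈ * DirichletCharacter.changeLevel (by norm_num : 4 ∣ 8) ZMod.χ₄ : MulChar (ZMod 8) ℤ) * DirichletCharacter.changeLevel (dvd_mul_left q 8) (quadraticChar (ZMod q)) :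
          MulChar (ZMod (8 * q)) ℤ).ringHomComp (Int.castRingHom (ZMod 3)) :
        DirichletCharacter (ZMod 3) (8 * q)) := by
  haveI : NeZero (8 * q) := ⟨mul_ne_zero (by norm_num) hq.out.ne_zero⟩
  have h4 : DirichletCharacter.conductor
      ((DirichletCharacter.changeLevel (dvd_refl 8) ZMod.χ₈ * DirichletCharacter.changeLevel (by norm_num : 4 ∣ 8) ZMod.χ₄ : MulChar (ZMod 8) ℤ).ringHomComp (Int.castRingHom (ZMod 3)) : DirichletCharacter (ZMod 3) 8) = 8 :=
    isPrimitive_eight_three_of_apply_five _ (by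
      rw [MulChar.ringHomComp_apply, MulChar.mul_apply,
        DirichletCharacter.changeLevel_eq_cast_of_dvd' _ (dvd_refl 8) (by rw [Int.isCoprime_iff_gcd_eq_one]; decide),
        DirichletCharacter.changeLevel_eq_cast_of_dvd' _ (by norm_num : 4 ∣ 8) (by rw [Int.isCoprime_iff_gcd_eq_one]; decide)]
      have h8 : ZMod.χ₈ ((5 : ℤ) : ZMod 8) = -1 := by decide
      have h4' : ZMod.χ₄ ((5 : ℤ) : ZMod 4) = 1 := by decide
      rw [h8, h4']
      simp)
  have hL : DirichletCharacter.conductor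
      ((quadraticChar (ZMod q)).ringHomComp (Int.castRingHom (ZMod 3)) : DirichletCharacter (ZMod 3) q) = q :=
    X3Branch.legendreCharacter_isPrimitive (p := 3) (q := q) (by decide) hq2
  have hcop : (DirichletCharacter.conductor (DirichletCharacter.changeLevel (dvd_mul_right 8 q)
        ((DirichletCharacter.changeLevel (dvd_refl 8) ZMod.χ₈ * DirichletCharacter.changeLevel (by norm_num : 4 ∣ 8) ZMod.χ₄ : MulChar (ZMod 8) ℤ).ringHomComp (Int.castRingHom (ZMod 3)) : DirichletCharacter (ZMod 3) 8))).Coprime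
      (DirichletCharacter.conductor (DirichletCharacter.changeLevel (dvd_mul_left q 8)
        ((quadraticChar (ZMod q)).ringHomComp (Int.castRingHom (ZMod 3)) : DirichletCharacter (ZMod 3) q))) := by
    rw [DirichletCharacter.conductor_changeLevel, DirichletCharacter.conductor_changeLevel, h4, hL]
    have : Nat.Coprime 8 q := by
      rw [show (8 : ℕ) = 2 ^ 3 by norm_num]
      exact Nat.Coprime.pow_left 3 ((Nat.coprime_primes Nat.prime_two hq.out).mpr (Ne.symm hq2))
    exact this
  rw [MulChar.ringHomComp_mul, DirichletCharacter.ringHomComp_changeLevel,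
    DirichletCharacter.ringHomComp_changeLevel, DirichletCharacter.isPrimitive_def,
    conductor_mul_eq_mul_of_coprime₅ _ _ hcop, DirichletCharacter.conductor_changeLevel, DirichletCharacter.conductor_changeLevel, h4, hL]

/-- **VALUE TABLE of `φ = (χ₈χ₄)·(·/q)` read in `𝔽₃`** on natural numbers: `φ(a) = χ₈(a)χ₄(a)·(a/q)` (cast to
`𝔽₃`) for `a` coprime to `8q`, else `0` — the decidable form consumed by the display kit III.
[cite: Washington1997, Ch. 3 (Dirichlet characters)] -/
theorem chi8chi4LegendreCharacter_three_apply_natCast (a : ℕ) :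
    ((DirichletCharacter.changeLevel (dvd_mul_right 8 q) (DirichletCharacter.changeLevel (dvd_refl 8) ZMod.χ₈ * DirichletCharacter.changeLevel (by norm_num : 4 ∣ 8) ZMod.χ₄ : MulChar (ZMod 8) ℤ) * DirichletCharacter.changeLevel (dvd_mul_left q 8) (quadraticChar (ZMod q)) :
          MulChar (ZMod (8 * q)) ℤ).ringHomComp (Int.castRingHom (ZMod 3)) :
        DirichletCharacter (ZMod 3) (8 * q)) (a : ZMod (8 * q)) =
      if a.Coprime (8 * q) then
        (((ZMod.χ₈ (a : ZMod 8) : ℤ) : ZMod 3) * ((ZMod.χ₄ (a : ZMod 4) : ℤ) : ZMod 3)) *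
          ((quadraticChar (ZMod q) (a : ZMod q) : ℤ) : ZMod 3)
      else 0 := by
  haveI : NeZero (8 * q) := ⟨mul_ne_zero (by norm_num) hq.out.ne_zero⟩
  by_cases hc : a.Coprime (8 * q)
  · rw [if_pos hc]
    have hu : IsUnit (a : ZMod (8 * q)) := (ZMod.isUnit_iff_coprime a (8 * q)).mpr hc
    obtain ⟨u, hu'⟩ := hu
    have hc8 : a.Coprime 8 := Nat.Coprime.coprime_mul_right_right hc
    have hu8 : IsUnit (a : ZMod 8) := (ZMod.isUnit_iff_coprime a 8).mpr hc8
    obtain ⟨u8, hu8'⟩ := hu8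
    rw [← hu', MulChar.ringHomComp_apply, MulChar.mul_apply, DirichletCharacter.changeLevel_eq_cast_of_dvd _ (dvd_mul_right 8 q),
      DirichletCharacter.changeLevel_eq_cast_of_dvd _ (dvd_mul_left q 8), hu', ZMod.cast_natCast (dvd_mul_right 8 q),
      ZMod.cast_natCast (dvd_mul_left q 8), ← hu8', MulChar.mul_apply,
      DirichletCharacter.changeLevel_eq_cast_of_dvd _ (dvd_refl 8),
      DirichletCharacter.changeLevel_eq_cast_of_dvd _ (by norm_num : 4 ∣ 8), hu8', ZMod.cast_natCast (dvd_refl 8),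
      ZMod.cast_natCast (by norm_num : 4 ∣ 8), map_mul, map_mul, eq_intCast, eq_intCast, eq_intCast]
  · rw [if_neg hc]
    exact MulChar.map_nonunit _ (fun h ↦ hc ((ZMod.isUnit_iff_coprime a (8 * q)).mp h))

variable {W : WeierstrassCurve ℚ} [W.IsElliptic]

/-- **The line datum WITH ITS TWO CHARACTERS for a kernel discriminant `D = 2q`, `q ≡ 3 (mod 4)` prime,
`q ≠ 3`.** From the certificate `(x₀, s)` (`Ψ₃(x₀) = 0`, `s ≠ 0`, `2q·s² = Ψ₂Sq(x₀)`): the rational `3`-line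
`Φ₀` (even, non-trivial action, `χ_K`-twist ramified at `3`) on which `Γ_ℚ` acts through the PRIMITIVE
character `φ = (χ₈χ₄)·(·/q)` read in `𝔽₃` (radical `√(2q) = √2·ζ₄·√q*`, `q* = −q`), with the PRIMITIVE quotient
character `ψ = ω₃·φ⁻¹` of level `3·(8q)` on `W[3]/Φ₀` (`exists_lineDatum_three_characters_of_cert_quadratic`).
[folklore] -/
theorem exists_lineDatum_three_characters_of_cert_two_mul_prime_three_mod_four [hp : Fact (Nat.Prime 3)]
    {x₀ s : ℚ} (hq4 : q % 4 = 3) (hq3 : q ≠ 3)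
    (hψ : W.Ψ₃.eval x₀ = 0) (hs : s ≠ 0) (hDs : ((2 * q : ℤ) : ℚ) * s ^ 2 = W.Ψ₂Sq.eval x₀) :
    ∃ Φ₀ : AddSubgroup (geomTorsion W ((3 : ℕ) : ℤ)), IsRationalLine W 3 Φ₀ ∧ LineEven W 3 Φ₀ ∧
      (∃ (σ : absoluteGaloisGroup ℚ) (P : W.geomTorsion ((3 : ℕ) : ℤ)), P ∈ Φ₀ ∧ σ • P ≠ P) ∧
      (∀ (K : Type) [Field K] [NumberField K] [(galRange (K := ℚ) K).Normal],
        Module.finrank ℚ K = 2 →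
        (∃ θ : K, θ ^ 2 = algebraMap ℚ K ((-1) ^ ((3 : ℕ) / 2) * (3 : ℕ))) →
        ¬ ∀ v : HeightOneSpectrum (𝓞 ℚ), (((3 : ℕ) : ℕ) : 𝓞 ℚ) ∈ v.asIdeal →
          ∀ 𝔓 ∈ v.primesAbove, ∀ σ ∈ 𝔓.inertia (absoluteGaloisGroup ℚ), ∀ P ∈ Φ₀,
            σ • P = (if σ ∈ galRange (K := ℚ) K then P else -P)) ∧
      DirichletCharacter.IsPrimitive
        ((DirichletCharacter.changeLevel (dvd_mul_right 8 q) (DirichletCharacter.changeLevel (dvd_refl 8) ZMod.χ₈ * DirichletCharacter.changeLevel (by norm_num : 4 ∣ 8) ZMod.χ₄ : MulChar (ZMod 8) ℤ) * DirichletCharacter.changeLevel (dvd_mul_left q 8) (quadraticChar (ZMod q)) :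
            MulChar (ZMod (8 * q)) ℤ).ringHomComp (Int.castRingHom (ZMod 3)) :
          DirichletCharacter (ZMod 3) (8 * q)) ∧
      (∀ (σ : absoluteGaloisGroup ℚ), ∀ P ∈ Φ₀,
        σ • P = (((DirichletCharacter.changeLevel (dvd_mul_right 8 q) (DirichletCharacter.changeLevel (dvd_refl 8) ZMod.χ₈ * DirichletCharacter.changeLevel (by norm_num : 4 ∣ 8) ZMod.χ₄ : MulChar (ZMod 8) ℤ) *
            DirichletCharacter.changeLevel (dvd_mul_left q 8) (quadraticChar (ZMod q)) : MulChar (ZMod (8 * q)) ℤ).ringHomComp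
            (Int.castRingHom (ZMod 3)) : DirichletCharacter (ZMod 3) (8 * q))
          ((modNCyclotomicCharacter ℚ (8 * q) σ : (ZMod (8 * q))ˣ) : ZMod (8 * q))).val • P) ∧
      DirichletCharacter.IsPrimitive
        (DirichletCharacter.changeLevel (dvd_mul_right 3 (8 * q)) (MulChar.ofUnitHom (MonoidHom.id (ZMod 3)ˣ)) *
          DirichletCharacter.changeLevel (dvd_mul_left (8 * q) 3)
            ((DirichletCharacter.changeLevel (dvd_mul_right 8 q) (DirichletCharacter.changeLevel (dvd_refl 8) ZMod.χ₈ * DirichletCharacter.changeLevel (by norm_num : 4 ∣ 8) ZMod.χ₄ : MulChar (ZMod 8) ℤ) *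
              DirichletCharacter.changeLevel (dvd_mul_left q 8) (quadraticChar (ZMod q)) : MulChar (ZMod (8 * q)) ℤ).ringHomComp
              (Int.castRingHom (ZMod 3)) : DirichletCharacter (ZMod 3) (8 * q))⁻¹ :
          DirichletCharacter (ZMod 3) (3 * (8 * q))) ∧
      (∀ (σ : absoluteGaloisGroup ℚ) (P : W.geomTorsion ((3 : ℕ) : ℤ)),
        σ • P - ((DirichletCharacter.changeLevel (dvd_mul_right 3 (8 * q)) (MulChar.ofUnitHom (MonoidHom.id (ZMod 3)ˣ)) *
          DirichletCharacter.changeLevel (dvd_mul_left (8 * q) 3)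
            ((DirichletCharacter.changeLevel (dvd_mul_right 8 q) (DirichletCharacter.changeLevel (dvd_refl 8) ZMod.χ₈ * DirichletCharacter.changeLevel (by norm_num : 4 ∣ 8) ZMod.χ₄ : MulChar (ZMod 8) ℤ) *
              DirichletCharacter.changeLevel (dvd_mul_left q 8) (quadraticChar (ZMod q)) : MulChar (ZMod (8 * q)) ℤ).ringHomComp
              (Int.castRingHom (ZMod 3)) : DirichletCharacter (ZMod 3) (8 * q))⁻¹ :
          DirichletCharacter (ZMod 3) (3 * (8 * q)))
          ((modNCyclotomicCharacter ℚ (3 * (8 * q)) σ : (ZMod (3 * (8 * q)))ˣ) : ZMod (3 * (8 * q)))).val • P ∈ Φ₀) := by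
  have hqpr : q.Prime := hq.out
  haveI : NeZero q := ⟨hqpr.ne_zero⟩
  haveI : NeZero (8 * q) := ⟨mul_ne_zero (by norm_num) hqpr.ne_zero⟩
  haveI : NeZero (q : ℚ) := ⟨by exact_mod_cast hqpr.ne_zero⟩
  have hq2 : q ≠ 2 := by rintro rfl; norm_num at hq4
  have hsq : Squarefree (2 * q : ℤ) := by
    have h2q : Squarefree (2 * q) := by
      rw [Nat.squarefree_mul ((Nat.coprime_primes Nat.prime_two hqpr).mpr (Ne.symm hq2))]
      exact ⟨Nat.prime_two.squarefree, hqpr.squarefree⟩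
    exact_mod_cast (Int.squarefree_natCast.mpr h2q)
  have hpos : (0 : ℤ) < 2 * q := by
    have : (0 : ℤ) < q := by exact_mod_cast hqpr.pos
    linarith
  have hq1 : (2 * q : ℤ) ≠ 1 := by omega
  have h3q : ¬ 3 ∣ q := by
    intro h
    rcases (Nat.dvd_prime hqpr).mp h with h1 | h1
    · norm_num at h1
    · exact hq3 h1.symm
  have h3q' : ¬ (3 : ℤ) ∣ (2 * q : ℤ) := by
    intro h
    have h' : (3 : ℤ) ∣ (q : ℤ) := (Int.Prime.dvd_mul' (by norm_num) h).resolve_left (by norm_num)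
    exact h3q (by exact_mod_cast h')
  have h3N : ¬ 3 ∣ 8 * q := by
    intro h
    rcases (Nat.Prime.dvd_mul Nat.prime_three).mp h with h | h
    · norm_num at h
    · exact h3q h
  -- the radical `√(2q) = √2 · ζ₄ · (Gauss sum of (·/q))`
  obtain ⟨r, hr0, hr2, hr⟩ := Rat.exists_sqrt_two_smul_eq_chi8
  obtain ⟨z, hz0, hz2, hz⟩ := Rat.exists_sqrt_neg_one_smul_eq_chi4
  obtain ⟨t, ht0, ht2, ht⟩ := Rat.exists_gaussSum (p := q) hq2
  have hqchar : ringChar (ZMod q) ≠ 2 := by rwa [ZMod.ringChar_zmod_n]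
  have ht2' : t ^ 2 = -(q : AlgebraicClosure ℚ) := by
    rw [ht2, quadraticChar_neg_one hqchar, ZMod.card q, ZMod.χ₄_nat_three_mod_four hq4]
    push_cast
    ring
  have hi := Rat.smul_mul_eq_changeLevel_mul (dvd_refl 8) (by norm_num : 4 ∣ 8) ZMod.χ₈ ZMod.χ₄ hr hz
  have hg2 : ((r * z) * t) ^ 2 = (((2 * q : ℤ) : ℚ) : AlgebraicClosure ℚ) := by
    rw [mul_pow, mul_pow, hr2, hz2, ht2']
    push_cast
    ring
  have hg0 : (r * z) * t ≠ 0 := mul_ne_zero (mul_ne_zero hr0 hz0) ht0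
  have hgs := Rat.smul_mul_eq_changeLevel_mul (dvd_mul_right 8 q) (dvd_mul_left q 8) (DirichletCharacter.changeLevel (dvd_refl 8) ZMod.χ₈ * DirichletCharacter.changeLevel (by norm_num : 4 ∣ 8) ZMod.χ₄ : MulChar (ZMod 8) ℤ)
    (quadraticChar (ZMod q)) hi ht
  have hχ2 : ((DirichletCharacter.changeLevel (dvd_mul_right 8 q) (DirichletCharacter.changeLevel (dvd_refl 8) ZMod.χ₈ * DirichletCharacter.changeLevel (by norm_num : 4 ∣ 8) ZMod.χ₄ : MulChar (ZMod 8) ℤ) *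
      DirichletCharacter.changeLevel (dvd_mul_left q 8) (quadraticChar (ZMod q)) : MulChar (ZMod (8 * q)) ℤ)).IsQuadratic :=
    MulChar.IsQuadratic.mul_int
      (MulChar.IsQuadratic.changeLevel_int
        (MulChar.IsQuadratic.mul_int (MulChar.IsQuadratic.changeLevel_int ZMod.isQuadratic_χ₈ _)
          (MulChar.IsQuadratic.changeLevel_int ZMod.isQuadratic_χ₄ _)) _)
      (MulChar.IsQuadratic.changeLevel_int (quadraticChar_isQuadratic (ZMod q)) _)
  exact exists_lineDatum_three_characters_of_cert_quadratic _ hχ2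
    (chi8chi4LegendreCharacter_three_isPrimitive hq2) h3N hg0 hg2 hgs hψ hsq hs hDs hpos hq1 h3q'

end Summit.BirchSwinnertonDyer.Rank1Residual.Additive

end
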